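import Literature.Geometry.Riemannian.NormalExponentialMap
import Literature.Geometry.Riemannian.ExpMapDifferential
import HarnessLib

/-!
# The framed exponential map of an immersion (Lee 2018, Thm. 5.25, first step, any codimension)

`NormalExponentialMap.lean` treats the normal exponential map `(z, t) ↦ exp_{ι z}(t ν z)` of an
immersed HYPERSURFACE with one transverse field.  This file is the same construction in arbitrary
codimension, for a map `ι : N → M` together with a fibrewise LINEAR family of fields
`ν z : F →L[ℝ] T_{ι z}M` parametrised by a normed space `F` (a framing of a complement of
`dι(TN)`, e.g. `ν z x = Σ xᵢ νᵢ(z)` for transverse fields `ν₁, …, ν_d`; Lee 2018, p. 133: "the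
restriction of `exp` to the normal bundle", the normal bundle being trivialised by the frame):

  `E(z, x) = exp_{ι z}(ν z x)`,   `(z, x) ∈ N × F`.

Following the first paragraph of the printed proof of **Lee 2018, Thm. 5.25** exactly as in the
codimension-one file:

* `isOpen_framedExpDomain`, `mem_framedExpDomain_zero` — the natural domain
  `𝓓 = {(z, x) | 1 ∈ dom γ_{(ι z, ν z x)}}` is open and contains `N × {0}`;
* `contMDiffOn_framedExp`, `contMDiffAt_framedExp` — `E` is `C^k` on `𝓓`;
* `framedExp_zero` — `E(z, 0) = ι z`;
* `mfderiv_framedExp_fibre_zero`, `mfderiv_framedExp_zero_apply` —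
  **`dE_{(z,0)}(w, u) = dι_z(w) + ν z u`** (on `N × {0}` the map is `ι`; on the fibre `{z} × F`
  its differential at `0` is `ν z`, because `d(exp_x)_0(v)` is the velocity of `t ↦ exp_x(t v)`);
* `exists_continuousLinearEquiv_coprod`, `isLocalDiffeomorphAt_framedExp_zero` — if
  `(w, u) ↦ dι_z w + ν z u` is injective and `dim N + dim F = dim M` then `E` is a `C^k` local
  diffeomorphism at `(z, 0)` (inverse function theorem on manifolds);
* `contMDiffAt_totalSpaceMk_sum_smul` — the joint smoothness hypothesis for the family
  `ν z x = Σᵢ xᵢ νᵢ(z)` built from finitely many `C^k` fields along `ι`.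

No definitions, no named facts (D-0026).  Used for tubular neighbourhoods of framed curves
(`Literature/Geometry/Symplectic`, Honda–Perutz model charts along zero circles).

## References

* J. M. Lee, *Introduction to Riemannian Manifolds*, 2nd ed., GTM 176 (2018), pp. 133–134,
  **Thm. 5.25** and the first paragraph of its proof; Prop. 5.19. [LeeRiemannianManifolds2018]
-/

noncomputable section

open Bundle Set Filter Function
open scoped Manifold ContDiff Topology

namespace Literature.Geometry.Riemannian

open Literature.Geometry.Lorentzian Literature.Geometry.Manifold

variable {E : Type*} [NormedAddCommGroup E] [NormedSpace ℝ E] {H : Type*} [TopologicalSpace H]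
  {I : ModelWithCorners ℝ E H} {M : Type*} [TopologicalSpace M] [ChartedSpace H M]
  [IsManifold I ∞ M]
  {E' : Type*} [NormedAddCommGroup E'] [NormedSpace ℝ E'] {H' : Type*} [TopologicalSpace H']
  {I' : ModelWithCorners ℝ E' H'} {N : Type*} [TopologicalSpace N] [ChartedSpace H' N]
  {F : Type*} [NormedAddCommGroup F] [NormedSpace ℝ F]
  {ι : N → M} {ν : Π z : N, F →L[ℝ] TangentSpace I (ι z)}

/-! ### The linear field built from finitely many sections -/

/-- **The field `(z, x) ↦ (ι z, Σᵢ xᵢ • νᵢ z) ∈ TM` is `C^n`** at `(z₀, x₀)` if each section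
`z ↦ (ι z, νᵢ z)` is `C^n` at `z₀` (in the trivialisation of `TM` at `ι z₀` the fibre coordinate
is `Σᵢ xᵢ •` that of `νᵢ`, a `C^n` expression). [folklore] -/
theorem contMDiffAt_totalSpaceMk_sum_smul {n : ℕ∞ω} {d : Type*} [Fintype d] {z₀ : N}
    {νs : d → Π z : N, TangentSpace I (ι z)} (hι : ContMDiffAt I' I n ι z₀)
    (hν : ∀ i, ContMDiffAt I' I.tangent n
      (fun z ↦ (TotalSpace.mk' E (ι z) (νs i z) : TangentBundle I M)) z₀) (x₀ : d → ℝ) :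
    ContMDiffAt (I'.prod 𝓘(ℝ, d → ℝ)) I.tangent n
      (fun q : N × (d → ℝ) ↦
        (TotalSpace.mk' E (ι q.1) (∑ i, q.2 i • νs i q.1) : TangentBundle I M)) (z₀, x₀) := by
  rw [ModelWithCorners.tangent] at hν ⊢
  simp_rw [Bundle.contMDiffAt_totalSpace] at hν ⊢
  have hfst : ContMDiffAt (I'.prod 𝓘(ℝ, d → ℝ)) I' n (Prod.fst : N × (d → ℝ) → N) (z₀, x₀) :=
    contMDiffAt_fst
  have hsnd : ContMDiffAt (I'.prod 𝓘(ℝ, d → ℝ)) 𝓘(ℝ, d → ℝ) n (Prod.snd : N × (d → ℝ) → d → ℝ)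
      (z₀, x₀) := contMDiffAt_snd
  have hι' : ContMDiffAt I' I n ι (Prod.fst (z₀, x₀)) := hι
  refine ⟨hι'.comp (z₀, x₀) hfst, ?_⟩
  set e := trivializationAt E (TangentSpace I : M → Type _) (ι z₀) with he
  have hsrc : ∀ᶠ q : N × (d → ℝ) in 𝓝 (z₀, x₀), ι q.1 ∈ (chartAt H (ι z₀)).source := by
    have h1 : ContinuousAt (fun q : N × (d → ℝ) ↦ ι q.1) (z₀, x₀) :=
      (hι'.comp (z₀, x₀) hfst).continuousAt
    exact h1.preimage_mem_nhds
      ((chartAt H (ι z₀)).open_source.mem_nhds (mem_chart_source H (ι z₀)))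
  -- fibrewise linearity of the trivialisation over the base set
  have hlin : ∀ q : N × (d → ℝ), ι q.1 ∈ (chartAt H (ι z₀)).source →
      (e ⟨ι q.1, ∑ i, q.2 i • νs i q.1⟩).2 = ∑ i, q.2 i • (e ⟨ι q.1, νs i q.1⟩).2 := by
    intro q hq
    have hqe : ι q.1 ∈ e.baseSet := by simpa [he] using hq
    rw [← Trivialization.continuousLinearMapAt_apply_of_mem ℝ e hqe, map_sum]
    refine Finset.sum_congr rfl fun i _ ↦ ?_
    rw [map_smul, Trivialization.continuousLinearMapAt_apply_of_mem ℝ e hqe]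
  have heq : (fun q : N × (d → ℝ) ↦ ∑ i, q.2 i • (e ⟨ι q.1, νs i q.1⟩).2) =ᶠ[𝓝 (z₀, x₀)]
      fun q : N × (d → ℝ) ↦ (e ⟨ι q.1, ∑ i, q.2 i • νs i q.1⟩).2 := by
    filter_upwards [hsrc] with q hq
    exact (hlin q hq).symm
  have hV : ∀ i, ContMDiffAt (I'.prod 𝓘(ℝ, d → ℝ)) 𝓘(ℝ, E) n
      (fun q : N × (d → ℝ) ↦ (e ⟨ι q.1, νs i q.1⟩).2) (z₀, x₀) := fun i ↦ by
    have h2 : ContMDiffAt I' 𝓘(ℝ, E) n (fun z ↦ (e ⟨ι z, νs i z⟩).2) (Prod.fst (z₀, x₀)) :=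
      (hν i).2
    exact h2.comp (z₀, x₀) hfst
  have hcoord : ∀ i, ContMDiffAt (I'.prod 𝓘(ℝ, d → ℝ)) 𝓘(ℝ, ℝ) n
      (fun q : N × (d → ℝ) ↦ q.2 i) (z₀, x₀) := fun i ↦ by
    have hp : ContMDiff 𝓘(ℝ, d → ℝ) 𝓘(ℝ, ℝ) n (fun x : d → ℝ ↦ x i) :=
      (ContinuousLinearMap.proj (R := ℝ) (φ := fun _ : d ↦ ℝ) i).contMDiff
    exact (hp x₀).comp (z₀, x₀) hsnd
  have hsum : ContMDiffAt (I'.prod 𝓘(ℝ, d → ℝ)) 𝓘(ℝ, E) n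
      (fun q : N × (d → ℝ) ↦ ∑ i, q.2 i • (e ⟨ι q.1, νs i q.1⟩).2) (z₀, x₀) := by
    have := ContMDiffAt.sum (t := (Finset.univ : Finset d))
      (fun i _ ↦ (hcoord i).smul (hV i)) (x₀ := (z₀, x₀))
    simpa only [Finset.sum_apply, Pi.smul_apply'] using this
  exact hsum.congr_of_eventuallyEq heq.symm

/-! ### The framed exponential map: domain, smoothness, value and differential on `N × {0}` -/

section FramedExp

variable [FiniteDimensional ℝ E] [CompleteSpace E] [T2Space M] [BoundarylessManifold I M]
  {cov : CovariantDerivative I E (TangentSpace I : M → Type _)}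
  [CovariantDerivative.ContMDiffCovariantDerivative cov 1]

omit [TopologicalSpace N] in
/-- **`N × {0}` lies in the domain `𝓓 = {(z, x) | 1 ∈ dom γ_{(ι z, ν z x)}}`** of the framed
exponential map (`ν z 0 = 0` and `exp_x` is defined at `0`). [cite: LeeRiemannianManifolds2018, p. 133] -/
theorem mem_framedExpDomain_zero (z : N) :
    (1 : ℝ) ∈ maximalGeodesicDomain cov (ι z) (ν z 0) := by
  rw [map_zero, mem_maximalGeodesicDomain_iff_smul_mem_expDomain, smul_zero]
  exact zero_mem_expDomain (cov := cov) (ι z)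

variable {k : ℕ∞} [CovariantDerivative.ContMDiffCovariantDerivative cov k]

/-- **The domain `𝓓` of the framed exponential map is open** in `N × F` (preimage of the open
set `𝓔 ⊆ TM`, `isOpen_setOf_one_mem_maximalGeodesicDomain`, under the continuous field
`(z, x) ↦ (ι z, ν z x)`). [cite: LeeRiemannianManifolds2018, Prop. 5.19 (a) and p. 133] -/
theorem isOpen_framedExpDomain (hk : 1 ≤ k)
    (hν : ContMDiff (I'.prod 𝓘(ℝ, F)) I.tangent k
      (fun q : N × F ↦ (TotalSpace.mk' E (ι q.1) (ν q.1 q.2) : TangentBundle I M))) :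
    IsOpen {q : N × F | (1 : ℝ) ∈ maximalGeodesicDomain cov (ι q.1) (ν q.1 q.2)} :=
  (isOpen_setOf_one_mem_maximalGeodesicDomain (cov := cov) hk).preimage hν.continuous

/-- **The framed exponential map `E(z, x) = exp_{ι z}(ν z x)` is `C^k` on its domain `𝓓`** for a
`C^k` connection (`exp` is `C^k` on `𝓔 ⊆ TM`, `contMDiffOn_expMap_totalSpace`, composed with the
`C^k` field). [cite: LeeRiemannianManifolds2018, Prop. 5.19 (a) and Thm. 5.25 (proof)] -/
theorem contMDiffOn_framedExp (hk : 1 ≤ k)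
    (hν : ContMDiff (I'.prod 𝓘(ℝ, F)) I.tangent k
      (fun q : N × F ↦ (TotalSpace.mk' E (ι q.1) (ν q.1 q.2) : TangentBundle I M))) :
    ContMDiffOn (I'.prod 𝓘(ℝ, F)) I k (fun q : N × F ↦ expMap cov (ι q.1) (ν q.1 q.2))
      {q : N × F | (1 : ℝ) ∈ maximalGeodesicDomain cov (ι q.1) (ν q.1 q.2)} :=
  (contMDiffOn_expMap_totalSpace (cov := cov) hk).comp hν.contMDiffOn fun _ hq ↦ hq

/-- `E(z, x)` is `C^k` at every point of `𝓓`, in particular at `(z, 0)`.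
[cite: LeeRiemannianManifolds2018, Thm. 5.25 (proof)] -/
theorem contMDiffAt_framedExp (hk : 1 ≤ k)
    (hν : ContMDiff (I'.prod 𝓘(ℝ, F)) I.tangent k
      (fun q : N × F ↦ (TotalSpace.mk' E (ι q.1) (ν q.1 q.2) : TangentBundle I M)))
    {z : N} {x : F} (hx : (1 : ℝ) ∈ maximalGeodesicDomain cov (ι z) (ν z x)) :
    ContMDiffAt (I'.prod 𝓘(ℝ, F)) I k (fun q : N × F ↦ expMap cov (ι q.1) (ν q.1 q.2)) (z, x) :=
  (contMDiffOn_framedExp hk hν).contMDiffAt ((isOpen_framedExpDomain hk hν).mem_nhds hx)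

omit [CovariantDerivative.ContMDiffCovariantDerivative cov k] [TopologicalSpace N] in
/-- **`E(z, 0) = ι z`** (`ν z 0 = 0`, `exp_x(0) = x`). [cite: LeeRiemannianManifolds2018, Thm. 5.25 (proof)] -/
theorem framedExp_zero (z : N) : expMap cov (ι z) (ν z 0) = ι z := by
  rw [map_zero]
  exact expMap_zero (cov := cov) (ι z)

/-- **The differential of `x ↦ exp_{ι z}(ν z x)` at `0` is `ν z`**: applied to `u` it is the
velocity at `0` of `s ↦ exp_{ι z}(s ν z u)`, i.e. `ν z u` (Lee 2018, Prop. 5.19 (d):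
`d(exp_p)_0 = id`, composed with the linear map `ν z`). [cite: LeeRiemannianManifolds2018, Prop. 5.19] -/
theorem mfderiv_framedExp_fibre_zero (hk : 1 ≤ k)
    (hν : ContMDiff (I'.prod 𝓘(ℝ, F)) I.tangent k
      (fun q : N × F ↦ (TotalSpace.mk' E (ι q.1) (ν q.1 q.2) : TangentBundle I M)))
    (z : N) (u : F) :
    mfderiv 𝓘(ℝ, F) I (fun x : F ↦ expMap cov (ι z) (ν z x)) 0 u = ν z u := by
  have hk0 : ((k : ℕ∞ω)) ≠ 0 := by
    have : (1 : ℕ∞ω) ≤ k := by exact_mod_cast hk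
    exact (lt_of_lt_of_le zero_lt_one this).ne'
  -- differentiability of the fibre map at `0`
  have hE : ContMDiffAt (I'.prod 𝓘(ℝ, F)) I k (fun q : N × F ↦ expMap cov (ι q.1) (ν q.1 q.2))
      (z, (0 : F)) := contMDiffAt_framedExp hk hν (mem_framedExpDomain_zero z)
  have hincl : ContMDiffAt 𝓘(ℝ, F) (I'.prod 𝓘(ℝ, F)) k (fun x : F ↦ ((z, x) : N × F)) 0 :=
    contMDiffAt_const.prodMk contMDiffAt_id
  have hf : MDifferentiableAt 𝓘(ℝ, F) I (fun x : F ↦ expMap cov (ι z) (ν z x)) 0 :=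
    (hE.comp 0 hincl).mdifferentiableAt hk0
  have h1 : (fun s : ℝ ↦ expMap cov (ι z) (ν z ((0 : F) + s • u))) =
      fun s : ℝ ↦ expMap cov (ι z) (s • ν z u) := by
    funext s
    rw [zero_add, map_smul]
  have hA : (mfderiv 𝓘(ℝ, F) I (fun x : F ↦ expMap cov (ι z) (ν z x)) 0 u : E) =
      (velocity I (fun s : ℝ ↦ expMap cov (ι z) (ν z ((0 : F) + s • u))) 0 : E) :=
    (velocity_comp_lineAt_zero (I := I) hf u).symm
  have hB : (velocity I (fun s : ℝ ↦ expMap cov (ι z) (ν z ((0 : F) + s • u))) 0 : E) =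
      (velocity I (fun s : ℝ ↦ expMap cov (ι z) (s • ν z u)) 0 : E) := by
    rw [h1]
  have hC : (velocity I (fun s : ℝ ↦ expMap cov (ι z) (s • ν z u)) 0 : E) = ν z u :=
    velocity_expMap_smul_zero (cov := cov) (ι z) (ν z u)
  exact hA.trans (hB.trans hC)

/-- **The differential of the framed exponential map along the zero section**:
`dE_{(z,0)}(w, u) = dι_z(w) + ν z u` for `w ∈ T_zN`, `u ∈ F` — on `N × {0}` the map is `ι`, and on
the fibre `{z} × F` its differential at `0` is `ν z` (Lee: "`dE_{(x,0)}` maps `T_{(x,0)}P_0`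
isomorphically onto `T_xP` … on the fiber `E` agrees with `exp_x`"; `mfderiv_prod_eq_add`).
[cite: LeeRiemannianManifolds2018, Thm. 5.25 (proof)] -/
theorem mfderiv_framedExp_zero_apply (hk : 1 ≤ k)
    (hν : ContMDiff (I'.prod 𝓘(ℝ, F)) I.tangent k
      (fun q : N × F ↦ (TotalSpace.mk' E (ι q.1) (ν q.1 q.2) : TangentBundle I M)))
    (z : N) (q : TangentSpace (I'.prod 𝓘(ℝ, F)) (z, (0 : F))) :
    mfderiv (I'.prod 𝓘(ℝ, F)) I (fun q : N × F ↦ expMap cov (ι q.1) (ν q.1 q.2)) (z, 0) q =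
      mfderiv I' I ι z q.1 + ν z q.2 := by
  have hk0 : ((k : ℕ∞ω)) ≠ 0 := by
    have : (1 : ℕ∞ω) ≤ k := by exact_mod_cast hk
    exact (lt_of_lt_of_le zero_lt_one this).ne'
  have hd : MDifferentiableAt (I'.prod 𝓘(ℝ, F)) I
      (fun q : N × F ↦ expMap cov (ι q.1) (ν q.1 q.2)) (z, 0) :=
    (contMDiffAt_framedExp hk hν (mem_framedExpDomain_zero z)).mdifferentiableAt hk0
  rw [mfderiv_prod_eq_add_apply hd]
  show mfderiv I' I (fun z' : N ↦ expMap cov (ι z') (ν z' 0)) z q.1 +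
      mfderiv 𝓘(ℝ, F) I (fun x : F ↦ expMap cov (ι z) (ν z x)) 0 q.2 =
        mfderiv I' I ι z q.1 + ν z q.2
  have hfun : (fun z' : N ↦ expMap cov (ι z') (ν z' 0)) = ι := funext fun z' ↦ framedExp_zero z'
  rw [hfun, mfderiv_framedExp_fibre_zero hk hν z q.2]
  rfl

end FramedExp

/-! ### Linear algebra: `(w, u) ↦ A w + B u` as an isomorphism -/

section LinearAlgebra

variable {G : Type*} [NormedAddCommGroup G] [NormedSpace ℝ G]
  {G' : Type*} [NormedAddCommGroup G'] [NormedSpace ℝ G']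
  {G'' : Type*} [NormedAddCommGroup G''] [NormedSpace ℝ G'']
  [FiniteDimensional ℝ G] [FiniteDimensional ℝ G'] [FiniteDimensional ℝ G'']

/-- **`(w, u) ↦ A w + B u` is a linear isomorphism `G' × G'' ≃ G`** when it is injective and
`dim G' + dim G'' = dim G` (the step "`T_xM = T_xP ⊕ N_xP` … bijective for dimensional reasons"
of Lee's proof of Thm. 5.25). [cite: LeeRiemannianManifolds2018, Thm. 5.25 (proof)] -/
theorem exists_continuousLinearEquiv_coprod {A : G' →L[ℝ] G} {B : G'' →L[ℝ] G}
    (hinj : Injective (A.coprod B))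
    (hdim : Module.finrank ℝ G' + Module.finrank ℝ G'' = Module.finrank ℝ G) :
    ∃ L : (G' × G'') ≃L[ℝ] G, (L : G' × G'' →L[ℝ] G) = A.coprod B := by
  set T : G' × G'' →L[ℝ] G := A.coprod B with hT
  have hinj' : Injective (T : G' × G'' →ₗ[ℝ] G) := hinj
  have hdim' : Module.finrank ℝ (G' × G'') = Module.finrank ℝ G := by
    rw [Module.finrank_prod, hdim]
  set L₀ : (G' × G'') ≃ₗ[ℝ] G := LinearMap.linearEquivOfInjective (T : G' × G'' →ₗ[ℝ] G) hinj' hdim'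
    with hL₀
  refine ⟨L₀.toContinuousLinearEquiv, ?_⟩
  ext q
  · rfl
  · rfl

end LinearAlgebra

/-! ### The framed exponential map is a local diffeomorphism along the zero section -/

section LocalDiffeo

variable [FiniteDimensional ℝ E] [CompleteSpace E] [T2Space M] [BoundarylessManifold I M]
  [I.Boundaryless] [I'.Boundaryless] [FiniteDimensional ℝ E'] [CompleteSpace E']
  [IsManifold I' ∞ N] [FiniteDimensional ℝ F] [CompleteSpace F]
  {cov : CovariantDerivative I E (TangentSpace I : M → Type _)}
  [CovariantDerivative.ContMDiffCovariantDerivative cov 1]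
  {k : ℕ∞} [CovariantDerivative.ContMDiffCovariantDerivative cov k]

/-- **The framed exponential map is a `C^k` local diffeomorphism at every point of the zero
section** where `(w, u) ↦ dι_z w + ν z u` is injective and `dim N + dim F = dim M` (Lee 2018,
Thm. 5.25, first paragraph of the proof: `dE_{(z,0)}` is then a linear isomorphism, and the
inverse function theorem on manifolds, `isLocalDiffeomorphAt_of_mfderiv`, applies on the open
domain `𝓓 ∋ (z, 0)`). [cite: LeeRiemannianManifolds2018, Thm. 5.25 (proof, first paragraph)] -/
theorem isLocalDiffeomorphAt_framedExp_zero (hk : 1 ≤ k)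
    (hν : ContMDiff (I'.prod 𝓘(ℝ, F)) I.tangent k
      (fun q : N × F ↦ (TotalSpace.mk' E (ι q.1) (ν q.1 q.2) : TangentBundle I M)))
    {z : N} (hinj : Injective ((mfderiv I' I ι z).coprod (ν z : F →L[ℝ] E)))
    (hdim : Module.finrank ℝ E' + Module.finrank ℝ F = Module.finrank ℝ E) :
    IsLocalDiffeomorphAt (I'.prod 𝓘(ℝ, F)) I k
      (fun q : N × F ↦ expMap cov (ι q.1) (ν q.1 q.2)) (z, 0) := by
  have hk0 : ((k : ℕ∞ω)) ≠ 0 := by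
    have : (1 : ℕ∞ω) ≤ k := by exact_mod_cast hk
    exact (lt_of_lt_of_le zero_lt_one this).ne'
  obtain ⟨L, hL⟩ := exists_continuousLinearEquiv_coprod (G := E) (G' := E') (G'' := F)
    (A := mfderiv I' I ι z) (B := (ν z : F →L[ℝ] E)) hinj hdim
  refine isLocalDiffeomorphAt_of_mfderiv hk0 (isOpen_framedExpDomain hk hν)
    (mem_framedExpDomain_zero z) (contMDiffOn_framedExp hk hν) L ?_
  rw [hL]
  refine ContinuousLinearMap.ext fun q ↦ ?_
  change _ = mfderiv I' I ι z q.1 + ν z q.2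
  exact mfderiv_framedExp_zero_apply hk hν z q

end LocalDiffeo

end Literature.Geometry.Riemannian

end
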